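import Summits.HodgeConjecture.HodgeConjecture.Theorems.OrthogonalEnveloped.Negative.EnvelopeOfAlgebraic
import Summits.HodgeConjecture.HodgeConjecture.Theorems.EndoscopicMiddleDegreeOrthogonalEnvelopedCorrAlgebra
import Literature.AlgebraicGeometry.HodgeTheory.HodgeTypeConjugation

/-!
# Decomposable envelopes cannot close `OrthogonalEnveloped` (lead's negative lemma, line-independent)

Crux `stmt-HodgeConjecture-14300` = `EndoscopicMiddleDegree.OrthogonalEnveloped`: a rational `(n,n)`-class
`e ⊥ TW(D)` on a compact ball quotient `X` (`dim X = 2n`) is to be ENVELOPED by an algebraic class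
`γ ∈ N^{2n}H^{4n}((X ⊗ X)(ℂ); ℂ)`: `P_γ β = pr₁₊(pr₂^* β ∪ γ)` preserves rational classes, is
`(n,n)`-valued and fixes `e`.

WHAT IS PROVED (third lead lineage, seat c2, 2026-08-16; `--supports stmt-HodgeConjecture-14300`). With the
datum `UnitaryBallQuotientDatum` as typed, the algebraic classes on `X ⊗ X` that the tree can EXHIBIT are the
**decomposable** ones — the `ℂ`-span of the diagonal `Δ₊ 1` (`gysinDiagonal_one_mem_algebraicClasses`) and of
the exterior products `a ⊠ b = pr₁^* a ∪ pr₂^* b` (`cupProduct_map_fst_map_snd_mem_supportedClasses`). This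
file computes their actions and proves the DICHOTOMY every such envelope runs into:

* `pc_cross_apply`, `exists_pc_cross_eq_smul` — `P_{a ⊠ b} β = a ∪ pr₁₊pr₂^*(β ∪ b) = s · a`: a rank-one
  operator with image `ℂ · a` (Fulton, Young Tableaux App. B (6); the symmetric case `a = b` is the landed
  `pc_crossSq_apply`);
* `pc_mem_of_mem_span_cross` — hence for `δ` in the span of the `a ⊠ b` with `a ∈ A` (any subspace `A`),
  `P_δ` takes values in `A`;
* `decomposable_dichotomy` — for `γ = c • d + δ` with `P_d = 1` (e.g. `d = Δ₊1`: `pc_gysinDiagonal_one`, from the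
  landed `corrAction_gysinDiagonal_one`):
  if `P_γ e = e` and `P_γ` takes values in a subspace `T`, then EITHER `e ∈ A` (case `c = 0`) OR
  `H^{2n} = T + A` (case `c ≠ 0`: `β = c⁻¹(P_γ β - P_δ β)`);
* `decomposableEnvelope_dichotomy`, `diagonalEnvelope_dichotomy` — the crux's reading: `A = algebraicClasses X n`, `T` = the classes of
  type `(n,n)`: a decomposable envelope of `e` exists only if `e` is ALREADY ALGEBRAIC (the Hodge conjecture
  for `e`, cf. the landed converse `Negative/EnvelopeOfAlgebraic`) or EVERY class of `H^{2n}(X(ℂ); ℂ)` is an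
  `(n,n)`-class plus an algebraic class (false as soon as `h^{2n,0}(X) ≠ 0`, PAPER).

So every proof of the crux in the present tree must produce an INDECOMPOSABLE algebraic cycle on `X ⊗ X`
adapted to `e` — on a ball quotient: a Hecke graph as a scheme-theoretic cycle, the construction behind the
shared stub `stub_heckePushPull` of all three lines (level covers as smooth projective schemes finite étale
over `X`: Riemann existence + GAGA), absent from the tree. Nothing here refutes the crux (it is HC-implied,
`Negative/EnvelopeOfAlgebraic`); it delimits what an envelope must be made of.

References: W. Fulton, *Young Tableaux* (1997), App. B §B.1 (5)–(6); W. Fulton, *Intersection Theory*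
(1998), §16.1 Prop. 16.1.1; C. Voisin, *Hodge Theory II* (2003), Prop. 9.20, proof of Thm. 10.17.
-/

noncomputable section

-- The mandated namespace `Summit.<P>.<Sub>.Theorems.…` repeats `HodgeConjecture` (single-conjunct summit).
set_option linter.dupNamespace false

namespace Summit.HodgeConjecture.HodgeConjecture.Theorems.OrthogonalEnveloped.Negative.DecomposableEnvelope

open CategoryTheory MonoidalCategory CartesianMonoidalCategory
open Literature.AlgebraicGeometry Literature.AlgebraicGeometry.Motives
  Literature.AlgebraicGeometry.HodgeTheory Literature.AlgebraicTopology.SingularHomology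
open Summit.HodgeConjecture.HodgeConjecture.Theorems.OrthogonalEnveloped.Negative.EnvelopeOfAlgebraic
  (Pc pc_apply fibreIntegral two_add_two)
open Summit.HodgeConjecture.HodgeConjecture.Cruxes.OrthogonalEnveloped.ImpureBarrenEnvelope
  (corrAction_gysinDiagonal_one gysinDiagonal_one_mem_algebraicClasses)

variable {m : ℕ} {X : SchemeOver ℂ}

/-! ### Exterior products act by rank-one operators -/

/-- **`P_{a ⊠ b}(β) = a ∪ pr₁₊ pr₂^*(β ∪ b)`**: `pr₂^*β ∪ (pr₁^*a ∪ pr₂^*b) = pr₁^*a ∪ pr₂^*(β ∪ b)`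
(associativity, graded commutativity in even degrees, multiplicativity of `pr₂^*`) and the projection
formula `pr₁₊(pr₁^* a ∪ y) = a ∪ pr₁₊ y`. [cite: FultonYoungTableaux1997, Appendix B §B.1 (6)]
[cite: HatcherAT2002, §3.2 Prop. 3.10 and Thm. 3.11] -/
theorem pc_cross_apply (μ : OrientationFamily) (hX : IsSmoothProjective (2 * (m + 1)) X)
    (a b β : complexBetti X (2 * (m + 1))) :
    Pc μ hX (cupProduct (two_add_two m) (complexBetti.map (fst X X) (2 * (m + 1)) a)
        (complexBetti.map (snd X X) (2 * (m + 1)) b)) β =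
      cupProduct (Nat.add_zero _) a (fibreIntegral μ hX (cupProduct (two_add_two m) β b)) := by
  have hS : 2 * (2 * (m + 1)) + 2 * (m + 1) = 2 * (m + 1) + 2 * (2 * (m + 1)) := by ring
  have h1 : cupProduct (rfl : 2 * (m + 1) + 2 * (2 * (m + 1)) = 2 * (m + 1) + 2 * (2 * (m + 1)))
      (complexBetti.map (snd X X) (2 * (m + 1)) β)
        (cupProduct (two_add_two m) (complexBetti.map (fst X X) (2 * (m + 1)) a)
          (complexBetti.map (snd X X) (2 * (m + 1)) b)) =
      cupProduct (rfl : 2 * (m + 1) + 2 * (2 * (m + 1)) = 2 * (m + 1) + 2 * (2 * (m + 1)))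
        (complexBetti.map (fst X X) (2 * (m + 1)) a)
        (complexBetti.map (snd X X) (2 * (2 * (m + 1))) (cupProduct (two_add_two m) β b)) := by
    rw [← cupProduct_assoc (two_add_two m) (two_add_two m) hS rfl,
      cupProduct_gradedComm_holds ℂ _ (two_add_two m) (two_add_two m)
        (complexBetti.map (snd X X) (2 * (m + 1)) β) (complexBetti.map (fst X X) (2 * (m + 1)) a),
      show ((-1 : ℂ) ^ (2 * (m + 1) * (2 * (m + 1)))) = 1 by
        rw [show 2 * (m + 1) * (2 * (m + 1)) = 2 * ((m + 1) * (2 * (m + 1))) by ring, pow_mul,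
          neg_one_sq, one_pow],
      one_smul, cupProduct_assoc (two_add_two m) (two_add_two m) hS rfl, cupProduct_map]
  rw [pc_apply, h1, complexGysin_cup (OrientationFamily.hasPoincareDuality μ)
    (IsSmoothProjective.tensor_holds hX hX) hX (fst X X) rfl _
    (show 2 * (2 * (m + 1)) + 2 * (2 * (m + 1)) = 0 + 2 * (2 * (m + 1) + 2 * (m + 1)) by ring)
    (Nat.add_zero _)]
  rfl

/-- Scalar form: `pr₁₊ pr₂^*(β ∪ b) = s · 1` (`H⁰(X(ℂ); ℂ) = ℂ · 1`) and then `P_{a ⊠ b}(β) = s · a` —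
the action of an exterior product is a RANK-ONE operator with image `ℂ · a`.
[cite: FultonYoungTableaux1997, Appendix B §B.1 (6)] [cite: HatcherAT2002, §3.3 Thm. 3.26] -/
theorem exists_pc_cross_eq_smul (μ : OrientationFamily) (hX : IsSmoothProjective (2 * (m + 1)) X)
    (a b β : complexBetti X (2 * (m + 1))) :
    ∃ s : ℂ, Pc μ hX (cupProduct (two_add_two m) (complexBetti.map (fst X X) (2 * (m + 1)) a)
        (complexBetti.map (snd X X) (2 * (m + 1)) b)) β = s • a := by
  obtain ⟨s, hs⟩ := exists_eq_smul_one μ hX (fibreIntegral μ hX (cupProduct (two_add_two m) β b))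
  exact ⟨s, by rw [pc_cross_apply, hs, map_smul, cupProduct_one]⟩

/-- **Span of exterior products**: if `δ` lies in the `ℂ`-span of the classes `a ⊠ b` with `a` in a
subspace `A ⊆ H^{2n}(X(ℂ); ℂ)` (and `b` arbitrary), then `P_δ β ∈ A` for every `β` (each generator acts
by a rank-one operator with image `ℂ · a ⊆ A`; `γ ↦ P_γ` is linear).
[cite: FultonYoungTableaux1997, Appendix B §B.1 (6)] -/
theorem pc_mem_of_mem_span_cross (μ : OrientationFamily) (hX : IsSmoothProjective (2 * (m + 1)) X)
    (A : Submodule ℂ (complexBetti X (2 * (m + 1))))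
    {δ : complexBetti (X ⊗ X) (2 * (2 * (m + 1)))}
    (hδ : δ ∈ Submodule.span ℂ {γ : complexBetti (X ⊗ X) (2 * (2 * (m + 1))) |
      ∃ a ∈ A, ∃ b : complexBetti X (2 * (m + 1)),
        γ = cupProduct (two_add_two m) (complexBetti.map (fst X X) (2 * (m + 1)) a)
          (complexBetti.map (snd X X) (2 * (m + 1)) b)})
    (β : complexBetti X (2 * (m + 1))) : Pc μ hX δ β ∈ A := by
  induction hδ using Submodule.span_induction with
  | mem γ hγ =>
    obtain ⟨a, ha, b, rfl⟩ := hγ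
    obtain ⟨s, hs⟩ := exists_pc_cross_eq_smul μ hX a b β
    rw [hs]
    exact A.smul_mem s ha
  | zero =>
    have h0 : Pc μ hX 0 = 0 := map_zero _
    rw [h0, LinearMap.zero_apply]
    exact A.zero_mem
  | add γ γ' _ _ hγ hγ' =>
    have h : Pc μ hX (γ + γ') = Pc μ hX γ + Pc μ hX γ' := map_add _ _ _
    rw [h, LinearMap.add_apply]
    exact A.add_mem hγ hγ'
  | smul c γ _ hγ =>
    have h : Pc μ hX (c • γ) = c • Pc μ hX γ := map_smul _ _ _
    rw [h, LinearMap.smul_apply]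
    exact A.smul_mem c hγ

/-! ### The diagonal, and the dichotomy -/

/-- **`P_{Δ₊ 1} = 1` in the crux's degree**: the diagonal class `Δ₊ 1 ∈ H^{4n}((X ⊗ X)(ℂ); ℂ)`
(`Δ = lift (𝟙 X) (𝟙 X)`), the unit of the ring of correspondences, acts as the identity (the landed
`corrAction_gysinDiagonal_one`); it is algebraic by the landed `gysinDiagonal_one_mem_algebraicClasses`.
So `d := Δ₊ 1` is an admissible `d` in the two dichotomies below. [cite: Fulton1998, §16.1 Prop. 16.1.1 and Def. 16.1.2] -/
theorem pc_gysinDiagonal_one {μ : OrientationFamily} (hμ : μ.HasPoincareDuality)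
    (hX : IsSmoothProjective (2 * (m + 1)) X) :
    Pc μ hX (complexGysin μ hX (IsSmoothProjective.tensor_holds hX hX) (lift (𝟙 X) (𝟙 X))
        (show 0 + 2 * (2 * (m + 1) + 2 * (m + 1)) = 2 * (2 * (m + 1)) + 2 * (2 * (m + 1)) by omega)
        (singularCohomology.one ℂ (ComplexPoints X))) = LinearMap.id :=
  corrAction_gysinDiagonal_one hμ hX (2 * (m + 1))

/-- The diagonal class is algebraic on `X ⊗ X` (codimension `2(m+1) = dim X`), restated in the crux's
degree bookkeeping. [cite: FultonYoungTableaux1997, Appendix B §B.2 Exercise 5 and §B.3] -/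
theorem gysinDiagonal_one_mem (μ : OrientationFamily) (hμ : μ.HasPoincareDuality)
    (hX : IsSmoothProjective (2 * (m + 1)) X) :
    complexGysin μ hX (IsSmoothProjective.tensor_holds hX hX) (lift (𝟙 X) (𝟙 X))
        (show 0 + 2 * (2 * (m + 1) + 2 * (m + 1)) = 2 * (2 * (m + 1)) + 2 * (2 * (m + 1)) by omega)
        (singularCohomology.one ℂ (ComplexPoints X)) ∈ algebraicClasses (X ⊗ X) (2 * (m + 1)) :=
  gysinDiagonal_one_mem_algebraicClasses μ hμ hX

/-- **The dichotomy of a decomposable envelope (abstract form).** Let `γ = c • d + δ` with `P_d = 1`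
(e.g. `d = Δ₊ 1`, `pc_gysinDiagonal_one`) and `δ` in the span of the exterior products `a ⊠ b`, `a ∈ A`.
If `P_γ` fixes `e` and takes all its values in a subspace `T`, then either `e ∈ A` (when `c = 0`:
`e = P_γ e = P_δ e`), or `T + A` is everything (when `c ≠ 0`: `β = c⁻¹ • (P_γ β - P_δ β)`).
[cite: Fulton1998, §16.1 Prop. 16.1.1] [cite: FultonYoungTableaux1997, Appendix B §B.1 (6)] -/
theorem decomposable_dichotomy (μ : OrientationFamily)
    (hX : IsSmoothProjective (2 * (m + 1)) X) (A T : Submodule ℂ (complexBetti X (2 * (m + 1))))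
    {d : complexBetti (X ⊗ X) (2 * (2 * (m + 1)))} (hd : Pc μ hX d = LinearMap.id)
    (c : ℂ) {δ : complexBetti (X ⊗ X) (2 * (2 * (m + 1)))}
    (hδ : δ ∈ Submodule.span ℂ {γ : complexBetti (X ⊗ X) (2 * (2 * (m + 1))) |
      ∃ a ∈ A, ∃ b : complexBetti X (2 * (m + 1)),
        γ = cupProduct (two_add_two m) (complexBetti.map (fst X X) (2 * (m + 1)) a)
          (complexBetti.map (snd X X) (2 * (m + 1)) b)})
    {e : complexBetti X (2 * (m + 1))} (hfix : Pc μ hX (c • d + δ) e = e)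
    (himg : ∀ β, Pc μ hX (c • d + δ) β ∈ T) :
    e ∈ A ∨ ∀ β, β ∈ T ⊔ A := by
  -- `P_γ β = c • β + P_δ β`
  have hP : ∀ β, Pc μ hX (c • d + δ) β = c • β + Pc μ hX δ β := by
    intro β
    have h1 : Pc μ hX (c • d + δ) = Pc μ hX (c • d) + Pc μ hX δ := map_add _ _ _
    have h2 : Pc μ hX (c • d) = c • Pc μ hX d := map_smul _ _ _
    rw [h1, h2, LinearMap.add_apply, LinearMap.smul_apply, hd, LinearMap.id_apply]
  by_cases hc : c = 0
  · left
    have h := hfix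
    rw [hP, hc, zero_smul, zero_add] at h
    rw [← h]
    exact pc_mem_of_mem_span_cross μ hX A hδ e
  · right
    intro β
    have hβ : β = c⁻¹ • (Pc μ hX (c • d + δ) β - Pc μ hX δ β) := by
      rw [hP, add_sub_cancel_right, smul_smul, inv_mul_cancel₀ hc, one_smul]
    rw [hβ]
    exact Submodule.smul_mem _ _ (Submodule.sub_mem _ (Submodule.mem_sup_left (himg β))
      (Submodule.mem_sup_right (pc_mem_of_mem_span_cross μ hX A hδ β)))

/-- **Decomposable envelopes cannot close the crux.** Let `X` be smooth projective of dimension `2(m+1)`,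
`μ` an orientation family, and `γ = c • d + δ` a DECOMPOSABLE class: `P_d = 1` (the diagonal `Δ₊ 1`,
`pc_gysinDiagonal_one`, algebraic by `gysinDiagonal_one_mem`) and `δ` in the span of the exterior
products `a ⊠ b` with `a` ALGEBRAIC (`a ∈ algebraicClasses X (m+1)`, `b` arbitrary — this span contains
every exterior product of algebraic classes, the only algebraic classes on `X ⊗ X` the tree exhibits besides
the diagonal). If `P_γ` is `(m+1,m+1)`-valued and fixes `e` — two of the three conclusions of
`OrthogonalEnveloped` — then EITHER `e` is already algebraic (the Hodge conjecture for `e`; compare the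
landed converse `Negative/EnvelopeOfAlgebraic.conclusion_of_mem_algebraicClasses`) OR every class in
`H^{2(m+1)}(X(ℂ); ℂ)` is an `(m+1,m+1)`-class plus an algebraic class (i.e. `H^{2n} = H^{n,n}`, false
whenever `h^{2n,0}(X) ≠ 0`). Consequently an envelope of a theta-orthogonal class must be built from an
INDECOMPOSABLE cycle on `X ⊗ X` (a Hecke graph), which the present datum cannot supply as a scheme.
[cite: Fulton1998, §16.1 Prop. 16.1.1] [cite: VoisinHodgeII2003, Prop. 9.20 and proof of Thm. 10.17 (10.7)] -/
theorem decomposableEnvelope_dichotomy (μ : OrientationFamily)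
    (hX : IsSmoothProjective (2 * (m + 1)) X)
    {d : complexBetti (X ⊗ X) (2 * (2 * (m + 1)))} (hd : Pc μ hX d = LinearMap.id)
    (c : ℂ) {δ : complexBetti (X ⊗ X) (2 * (2 * (m + 1)))}
    (hδ : δ ∈ Submodule.span ℂ {γ : complexBetti (X ⊗ X) (2 * (2 * (m + 1))) |
      ∃ a ∈ algebraicClasses X (m + 1), ∃ b : complexBetti X (2 * (m + 1)),
        γ = cupProduct (two_add_two m) (complexBetti.map (fst X X) (2 * (m + 1)) a)
          (complexBetti.map (snd X X) (2 * (m + 1)) b)})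
    {e : complexBetti X (2 * (m + 1))} (hfix : Pc μ hX (c • d + δ) e = e)
    (himg : ∀ β, IsOfHodgeType (2 * (m + 1)) X (2 * (m + 1)) (m + 1) (m + 1)
      (Pc μ hX (c • d + δ) β)) :
    e ∈ algebraicClasses X (m + 1) ∨
      ∀ β : complexBetti X (2 * (m + 1)), ∃ x a : complexBetti X (2 * (m + 1)),
        IsOfHodgeType (2 * (m + 1)) X (2 * (m + 1)) (m + 1) (m + 1) x ∧
          a ∈ algebraicClasses X (m + 1) ∧ β = x + a := by
  -- read the Hodge types in one Hodge model (supplied by `himg 0`)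
  obtain ⟨M, -⟩ := himg 0
  let T : Submodule ℂ (complexBetti X (2 * (m + 1))) :=
    (M.hodgePQ (2 * (m + 1)) (m + 1) (m + 1)).comap (M.pullback (2 * (m + 1))).hom
  have hT : ∀ x, x ∈ T ↔ IsOfHodgeType (2 * (m + 1)) X (2 * (m + 1)) (m + 1) (m + 1) x :=
    fun x ↦ (isOfHodgeType_iff_mem_hodgePQ hX M x).symm
  rcases decomposable_dichotomy μ hX (algebraicClasses X (m + 1)) T hd c hδ hfix
      (fun β ↦ (hT _).2 (himg β)) with h | h
  · exact Or.inl h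
  · refine Or.inr fun β ↦ ?_
    obtain ⟨x, hx, a, ha, hxa⟩ := Submodule.mem_sup.1 (h β)
    exact ⟨x, a, (hT x).1 hx, ha, hxa.symm⟩

/-- **The diagonal instance**, spelled out: for `γ = c • Δ₊1 + δ` with `δ` decomposable over the
algebraic classes, `P_γ e = e` and `P_γ` purely `(m+1,m+1)`-valued force `e` algebraic or
`H^{2(m+1)} = H^{m+1,m+1} +` algebraic. [cite: Fulton1998, §16.1 Prop. 16.1.1] -/
theorem diagonalEnvelope_dichotomy {μ : OrientationFamily} (hμ : μ.HasPoincareDuality)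
    (hX : IsSmoothProjective (2 * (m + 1)) X) (c : ℂ) {δ : complexBetti (X ⊗ X) (2 * (2 * (m + 1)))}
    (hδ : δ ∈ Submodule.span ℂ {γ : complexBetti (X ⊗ X) (2 * (2 * (m + 1))) |
      ∃ a ∈ algebraicClasses X (m + 1), ∃ b : complexBetti X (2 * (m + 1)),
        γ = cupProduct (two_add_two m) (complexBetti.map (fst X X) (2 * (m + 1)) a)
          (complexBetti.map (snd X X) (2 * (m + 1)) b)})
    {e : complexBetti X (2 * (m + 1))}
    (hfix : Pc μ hX (c • complexGysin μ hX (IsSmoothProjective.tensor_holds hX hX) (lift (𝟙 X) (𝟙 X))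
        (show 0 + 2 * (2 * (m + 1) + 2 * (m + 1)) = 2 * (2 * (m + 1)) + 2 * (2 * (m + 1)) by omega)
        (singularCohomology.one ℂ (ComplexPoints X)) + δ) e = e)
    (himg : ∀ β, IsOfHodgeType (2 * (m + 1)) X (2 * (m + 1)) (m + 1) (m + 1)
      (Pc μ hX (c • complexGysin μ hX (IsSmoothProjective.tensor_holds hX hX) (lift (𝟙 X) (𝟙 X))
        (show 0 + 2 * (2 * (m + 1) + 2 * (m + 1)) = 2 * (2 * (m + 1)) + 2 * (2 * (m + 1)) by omega)
        (singularCohomology.one ℂ (ComplexPoints X)) + δ) β)) :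
    e ∈ algebraicClasses X (m + 1) ∨
      ∀ β : complexBetti X (2 * (m + 1)), ∃ x a : complexBetti X (2 * (m + 1)),
        IsOfHodgeType (2 * (m + 1)) X (2 * (m + 1)) (m + 1) (m + 1) x ∧
          a ∈ algebraicClasses X (m + 1) ∧ β = x + a :=
  decomposableEnvelope_dichotomy μ hX (pc_gysinDiagonal_one hμ hX) c hδ hfix himg

end Summit.HodgeConjecture.HodgeConjecture.Theorems.OrthogonalEnveloped.Negative.DecomposableEnvelope

end
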